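import Literature.AnabelianGeometry.AbsoluteAnabelian.AutHolomorphicSpaces
import Mathlib.Analysis.Complex.UpperHalfPlane.Manifold
import Mathlib.Analysis.Complex.UpperHalfPlane.MoebiusAction
import HarnessLib

/-!
# The Cayley transform `unitDiscOpens ≃ₜ ℍ` (PROOF-ONLY support for [AbsTopIII] Prop. 2.2 (ii))

Bookkeeping between the tree's unit disc `unitDiscOpens : Opens ℂ` (t2's `AutHolomorphicSpaces`)
and Mathlib's upper half plane `ℍ` with its `SL(2, ℝ)` / `GL(2, ℝ)` Möbius actions:

* `exists_cayley` — a biholomorphic homeomorphism `C : unitDiscOpens ≃ₜ ℍ`,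
  `C w = i(1+w)/(1-w)`, `C⁻¹ z = (z-i)/(z+i)`, `C 0 = i`;
* `cayley_rotation_smul` — `C⁻¹ (k_t • z) = e^{-2it} · C⁻¹ z` for the rotation matrices
  `k_t = [[cos t, -sin t], [sin t, cos t]] ∈ SL(2, ℝ)` (the stabiliser of `i` acts on the disc by
  rotations), and every unit complex number is such an `e^{-2it}`;
* `mdifferentiableAt_upperHalfPlane_iff` / `mdifferentiableAt_comp_ofComplex_iff` — holomorphy of
  maps into / out of `ℍ` via the coordinate `ℍ ⊆ ℂ`.

[cite: MochizukiAbsTopIII2015, Proposition 2.2 (ii) p.52]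
-/

noncomputable section

namespace Literature.AnabelianGeometry.AbsoluteAnabelian

open _root_.TopologicalSpace _root_.Topology _root_.Set _root_.Metric _root_.Function _root_.Filter
open scoped _root_.Manifold _root_.ContDiff ComplexConjugate UpperHalfPlane MatrixGroups
open _root_.UpperHalfPlane

universe u

/-! ### Holomorphy of maps into and out of `ℍ` -/

section HolH

variable {M : Type u} [TopologicalSpace M] [ChartedSpace ℂ M]

/-- A map into `ℍ` is `ℂ`-differentiable at a point iff its composite with `ℍ ⊆ ℂ` is.
[cite: MochizukiAbsTopIII2015, Proposition 2.2 (ii) p.52] -/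
theorem mdifferentiableAt_upperHalfPlane_iff {F : M → ℍ} {x : M} :
    MDifferentiableAt 𝓘(ℂ, ℂ) 𝓘(ℂ, ℂ) F x ↔
      MDifferentiableAt 𝓘(ℂ, ℂ) 𝓘(ℂ, ℂ) (fun y => ((F y : ℍ) : ℂ)) x := by
  constructor
  · intro h
    exact (UpperHalfPlane.mdifferentiable_coe _).comp x h
  · intro h
    have hF : F = UpperHalfPlane.ofComplex ∘ fun y => ((F y : ℍ) : ℂ) := by
      funext y; simp [UpperHalfPlane.ofComplex_apply]
    rw [hF]
    exact (UpperHalfPlane.mdifferentiableAt_ofComplex (F x).im_pos).comp x h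

/-- A map out of `ℍ` is `ℂ`-differentiable at `τ` iff its composite with `ofComplex` is
`ℂ`-differentiable at `↑τ`. [cite: MochizukiAbsTopIII2015, Proposition 2.2 (ii) p.52] -/
theorem mdifferentiableAt_comp_ofComplex_iff {N : Type u} [TopologicalSpace N] [ChartedSpace ℂ N]
    {f : ℍ → N} {τ : ℍ} :
    MDifferentiableAt 𝓘(ℂ, ℂ) 𝓘(ℂ, ℂ) (f ∘ UpperHalfPlane.ofComplex) (τ : ℂ) ↔
      MDifferentiableAt 𝓘(ℂ, ℂ) 𝓘(ℂ, ℂ) f τ := by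
  constructor
  · intro h
    have hf : f = (f ∘ UpperHalfPlane.ofComplex) ∘ (fun z : ℍ => (z : ℂ)) := by
      funext z; simp [UpperHalfPlane.ofComplex_apply]
    rw [hf]
    exact h.comp τ (UpperHalfPlane.mdifferentiable_coe τ)
  · intro h
    have h' : MDifferentiableAt 𝓘(ℂ, ℂ) 𝓘(ℂ, ℂ) f (UpperHalfPlane.ofComplex (τ : ℂ)) := by
      rwa [UpperHalfPlane.ofComplex_apply]
    exact h'.comp _ (UpperHalfPlane.mdifferentiableAt_ofComplex τ.im_pos)

end HolH

/-! ### The Cayley transform -/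

/-- `(z-i)/(z+i)` lies in the unit ball for `Im z > 0`. [cite: MochizukiAbsTopIII2015, Proposition 2.2 (ii) p.52] -/
theorem norm_cayleyInv_lt_one {z : ℂ} (hz : 0 < z.im) : ‖(z - Complex.I) / (z + Complex.I)‖ < 1 := by
  have h2 : z + Complex.I ≠ 0 := by
    intro h
    have : z = -Complex.I := by linear_combination h
    rw [this] at hz; norm_num at hz
  rw [norm_div, div_lt_one (norm_pos_iff.2 h2)]
  have e1 : ‖z - Complex.I‖ ^ 2 = z.re ^ 2 + (z.im - 1) ^ 2 := by
    rw [Complex.sq_norm, Complex.normSq_apply]; simp; ring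
  have e2 : ‖z + Complex.I‖ ^ 2 = z.re ^ 2 + (z.im + 1) ^ 2 := by
    rw [Complex.sq_norm, Complex.normSq_apply]; simp; ring
  nlinarith [norm_nonneg (z - Complex.I), norm_nonneg (z + Complex.I), e1, e2]

/-- **The Cayley transform** `unitDiscOpens ≃ₜ ℍ`, `w ↦ i(1+w)/(1-w)`, with inverse
`z ↦ (z-i)/(z+i)`, biholomorphic, sending `0 ↦ i`. [cite: MochizukiAbsTopIII2015, Proposition 2.2 (ii) p.52] -/
theorem exists_cayley :
    ∃ C : unitDiscOpens ≃ₜ ℍ, MDifferentiable 𝓘(ℂ, ℂ) 𝓘(ℂ, ℂ) C ∧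
      MDifferentiable 𝓘(ℂ, ℂ) 𝓘(ℂ, ℂ) C.symm ∧
      (∀ w : unitDiscOpens, ((C w : ℍ) : ℂ) = Complex.I * (1 + (w : ℂ)) / (1 - (w : ℂ))) ∧
      (∀ z : ℍ, ((C.symm z : unitDiscOpens) : ℂ) = ((z : ℂ) - Complex.I) / ((z : ℂ) + Complex.I)) := by
  have hmemw : ∀ w : unitDiscOpens, ‖(w : ℂ)‖ < 1 := fun w => mem_ball_zero_iff.1 w.2
  have im_cayley_pos : ∀ {w : ℂ}, ‖w‖ < 1 → 0 < (Complex.I * (1 + w) / (1 - w)).im := by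
    intro w hw
    have h1 : (1 : ℂ) - w ≠ 0 := by
      intro h
      have : w = 1 := by linear_combination -h
      rw [this, norm_one] at hw
      exact lt_irrefl _ hw
    have hns : 0 < Complex.normSq (1 - w) := Complex.normSq_pos.2 h1
    have key : (Complex.I * (1 + w) / (1 - w)).im = (1 - ‖w‖ ^ 2) / Complex.normSq (1 - w) := by
      rw [Complex.div_im]
      simp only [Complex.mul_re, Complex.mul_im, Complex.I_re, Complex.I_im, Complex.add_re,
        Complex.add_im, Complex.one_re, Complex.one_im, Complex.sub_re, Complex.sub_im,
        Complex.sq_norm, Complex.normSq_apply]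
      field_simp
      ring
    rw [key]
    exact div_pos (by nlinarith [norm_nonneg w]) hns
  have h1w : ∀ w : unitDiscOpens, (1 : ℂ) - w ≠ 0 := by
    intro w h
    have : (w : ℂ) = 1 := by linear_combination -h
    have h' := hmemw w; rw [this, norm_one] at h'; exact lt_irrefl _ h'
  have hzi : ∀ z : ℍ, (z : ℂ) + Complex.I ≠ 0 := by
    intro z h
    have : (z : ℂ) = -Complex.I := by linear_combination h
    have h' : 0 < (z : ℂ).im := z.im_pos
    rw [this] at h'; norm_num at h'
  let toF : unitDiscOpens → ℍ := fun w =>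
    ⟨Complex.I * (1 + (w : ℂ)) / (1 - (w : ℂ)), im_cayley_pos (hmemw w)⟩
  let invF : ℍ → unitDiscOpens := fun z =>
    ⟨((z : ℂ) - Complex.I) / ((z : ℂ) + Complex.I), by
      show _ ∈ Metric.ball (0 : ℂ) 1
      rw [mem_ball_zero_iff]; exact norm_cayleyInv_lt_one z.im_pos⟩
  have hI0 : Complex.I ≠ 0 := Complex.I_ne_zero
  have hleft : ∀ w, invF (toF w) = w := by
    intro w
    apply Subtype.ext
    show (Complex.I * (1 + (w : ℂ)) / (1 - (w : ℂ)) - Complex.I) /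
      (Complex.I * (1 + (w : ℂ)) / (1 - (w : ℂ)) + Complex.I) = (w : ℂ)
    have hw := h1w w
    have e1 : Complex.I * (1 + (w : ℂ)) / (1 - (w : ℂ)) - Complex.I =
        2 * Complex.I * (w : ℂ) / (1 - (w : ℂ)) := by
      field_simp; ring
    have e2 : Complex.I * (1 + (w : ℂ)) / (1 - (w : ℂ)) + Complex.I =
        2 * Complex.I / (1 - (w : ℂ)) := by
      field_simp; ring
    rw [e1, e2]
    field_simp
  have hright : ∀ z, toF (invF z) = z := by
    intro z
    apply UpperHalfPlane.ext
    show Complex.I * (1 + ((z : ℂ) - Complex.I) / ((z : ℂ) + Complex.I)) /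
      (1 - ((z : ℂ) - Complex.I) / ((z : ℂ) + Complex.I)) = (z : ℂ)
    have hz := hzi z
    have e1 : 1 + ((z : ℂ) - Complex.I) / ((z : ℂ) + Complex.I) = 2 * (z : ℂ) / ((z : ℂ) + Complex.I) := by
      field_simp; ring
    have e2 : 1 - ((z : ℂ) - Complex.I) / ((z : ℂ) + Complex.I) = 2 * Complex.I / ((z : ℂ) + Complex.I) := by
      field_simp; ring
    rw [e1, e2]
    field_simp
  have hcontF : Continuous toF := by
    rw [UpperHalfPlane.isOpenEmbedding_coe.isInducing.continuous_iff]
    show Continuous fun w : unitDiscOpens => Complex.I * (1 + (w : ℂ)) / (1 - (w : ℂ))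
    exact Continuous.div (by fun_prop) (by fun_prop) h1w
  have hcontI : Continuous invF := by
    refine Continuous.subtype_mk ?_ _
    exact Continuous.div (by fun_prop) (by fun_prop) hzi
  let C : unitDiscOpens ≃ₜ ℍ :=
    { toFun := toF, invFun := invF, left_inv := hleft, right_inv := hright,
      continuous_toFun := hcontF, continuous_invFun := hcontI }
  have hCw : ∀ w : unitDiscOpens, ((C w : ℍ) : ℂ) = Complex.I * (1 + (w : ℂ)) / (1 - (w : ℂ)) :=
    fun w => rfl
  have hCz : ∀ z : ℍ, ((C.symm z : unitDiscOpens) : ℂ) = ((z : ℂ) - Complex.I) / ((z : ℂ) + Complex.I) :=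
    fun z => rfl
  refine ⟨C, ?_, ?_, hCw, hCz⟩
  · -- holomorphy of `C`
    intro w
    rw [mdifferentiableAt_upperHalfPlane_iff]
    -- reduce to the ambient function on the ball
    have hamb : MDifferentiableAt 𝓘(ℂ, ℂ) 𝓘(ℂ, ℂ)
        (fun v : ℂ => Complex.I * (1 + v) / (1 - v)) (w : ℂ) := by
      rw [mdifferentiableAt_iff_differentiableAt]
      have hw := h1w w
      exact DifferentiableAt.div (c := fun v : ℂ => Complex.I * (1 + v)) (d := fun v : ℂ => 1 - v)
        (by fun_prop) (by fun_prop) hw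
    have := ((differentiableWithinAt_localInvariantProp (I := 𝓘(ℂ, ℂ)) (I' := 𝓘(ℂ, ℂ))
      ).liftPropAt_iff_comp_subtype_val (fun v : ℂ => Complex.I * (1 + v) / (1 - v)) w).1 hamb
    exact this
  · -- holomorphy of `C⁻¹`
    intro z
    rw [← mdifferentiableAt_comp_ofComplex_iff]
    have hcod : MDifferentiableAt 𝓘(ℂ, ℂ) 𝓘(ℂ, ℂ)
        (Subtype.val ∘ (⇑C.symm ∘ UpperHalfPlane.ofComplex)) (z : ℂ) := by
      rw [mdifferentiableAt_iff_differentiableAt]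
      have hev : (fun v : ℂ => (v - Complex.I) / (v + Complex.I)) =ᶠ[𝓝 (z : ℂ)]
          Subtype.val ∘ (⇑C.symm ∘ UpperHalfPlane.ofComplex) := by
        filter_upwards [(UpperHalfPlane.isOpen_upperHalfPlaneSet).mem_nhds z.im_pos] with v hv
        simp only [comp_apply, UpperHalfPlane.ofComplex_apply_of_im_pos hv]
        rfl
      have hz := hzi z
      have hd : DifferentiableAt ℂ (fun v : ℂ => (v - Complex.I) / (v + Complex.I)) (z : ℂ) :=
        DifferentiableAt.div (c := fun v : ℂ => v - Complex.I) (d := fun v : ℂ => v + Complex.I)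
          (by fun_prop) (by fun_prop) hz
      exact hd.congr_of_eventuallyEq hev.symm
    exact (ChartedSpace.liftPropWithinAt_subtypeVal_comp_iff (⇑C.symm ∘ UpperHalfPlane.ofComplex)
      univ (z : ℂ)).1 hcod

/-! ### Rotations about `i` correspond to rotations of the disc -/

/-- The rotation matrix `k_t = [[cos t, -sin t], [sin t, cos t]]` as an element of `SL(2, ℝ)`.
(Existence form, to keep this file definition-free.) [cite: MochizukiAbsTopIII2015, Proposition 2.2 (ii) p.52] -/
theorem exists_rotation_SL2 (t : ℝ) :
    ∃ k : SL(2, ℝ), k 0 0 = Real.cos t ∧ k 0 1 = -Real.sin t ∧ k 1 0 = Real.sin t ∧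
      k 1 1 = Real.cos t := by
  refine ⟨⟨!![Real.cos t, -Real.sin t; Real.sin t, Real.cos t], ?_⟩, rfl, rfl, rfl, rfl⟩
  rw [Matrix.det_fin_two_of]
  nlinarith [Real.cos_sq_add_sin_sq t]

/-- **The stabiliser of `i` acts on the disc by rotations**: in the disc coordinate
`w = (z-i)/(z+i)`, the rotation matrix `k_t` acts as `w ↦ e^{-2it} w`, i.e.
`(k_t • z - i)/(k_t • z + i) = (cos t - i sin t)² · (z - i)/(z + i)`.
[cite: MochizukiAbsTopIII2015, Proposition 2.2 (ii) p.52] -/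
theorem cayley_rotation_smul {k : SL(2, ℝ)} {t : ℝ} (h00 : k 0 0 = Real.cos t)
    (h01 : k 0 1 = -Real.sin t) (h10 : k 1 0 = Real.sin t) (h11 : k 1 1 = Real.cos t) (z : ℍ) :
    (((k • z : ℍ) : ℂ) - Complex.I) / (((k • z : ℍ) : ℂ) + Complex.I) =
      ((Real.cos t : ℂ) - Complex.I * Real.sin t) ^ 2 * (((z : ℂ) - Complex.I) / ((z : ℂ) + Complex.I)) := by
  have hz : (z : ℂ) + Complex.I ≠ 0 := by
    intro h
    have : (z : ℂ) = -Complex.I := by linear_combination h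
    have h' : 0 < (z : ℂ).im := z.im_pos
    rw [this] at h'; norm_num at h'
  have hden : ((Real.sin t : ℝ) : ℂ) * (z : ℂ) + (Real.cos t : ℂ) ≠ 0 := by
    have := UpperHalfPlane.denom_ne_zero (k : GL (Fin 2) ℝ) z
    simpa [UpperHalfPlane.denom, h10, h11] using this
  rw [UpperHalfPlane.coe_specialLinearGroup_apply]
  simp only [h00, h01, h10, h11, Algebra.algebraMap_self, RingHom.id_apply, Complex.ofReal_neg]
  -- `e₁ := cos t - i sin t`, `e₂ := cos t + i sin t`, `e₂ e₁ = 1`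
  set e₁ : ℂ := (Real.cos t : ℂ) - Complex.I * Real.sin t with he₁
  set e₂ : ℂ := (Real.cos t : ℂ) + Complex.I * Real.sin t with he₂
  have hcs : (Real.cos t : ℂ) ^ 2 + (Real.sin t : ℂ) ^ 2 = 1 := by
    rw [← Complex.ofReal_pow, ← Complex.ofReal_pow, ← Complex.ofReal_add, Real.cos_sq_add_sin_sq]
    simp
  have he : e₂ * e₁ = 1 := by
    rw [he₁, he₂]
    linear_combination hcs + (-(Real.sin t : ℂ) ^ 2) * Complex.I_sq
  have he₁0 : e₁ ≠ 0 := fun h0 => by rw [h0, mul_zero] at he; exact zero_ne_one he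
  have he₂0 : e₂ ≠ 0 := fun h0 => by rw [h0, zero_mul] at he; exact zero_ne_one he
  have hN : (Real.cos t : ℂ) * (z : ℂ) + -(Real.sin t : ℂ) -
      ((Real.sin t : ℂ) * (z : ℂ) + Real.cos t) * Complex.I = e₁ * ((z : ℂ) - Complex.I) := by
    rw [he₁]
    linear_combination (-(Real.sin t : ℂ)) * Complex.I_sq
  have hD : (Real.cos t : ℂ) * (z : ℂ) + -(Real.sin t : ℂ) +
      Complex.I * ((Real.sin t : ℂ) * (z : ℂ) + Real.cos t) = e₂ * ((z : ℂ) + Complex.I) := by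
    rw [he₂]
    linear_combination (-(Real.sin t : ℂ)) * Complex.I_sq
  rw [div_sub' hden, div_add' _ _ _ hden, div_div_div_cancel_right₀ hden, hN, hD]
  have he₂' : e₂ = e₁⁻¹ := eq_inv_of_mul_eq_one_left he
  rw [he₂']
  field_simp

/-- Every unit complex number is `(cos t - i sin t)²` for some real `t`.
[cite: MochizukiAbsTopIII2015, Proposition 2.2 (ii) p.52] -/
theorem exists_cos_sub_sin_sq_eq {c : ℂ} (hc : ‖c‖ = 1) :
    ∃ t : ℝ, ((Real.cos t : ℂ) - Complex.I * Real.sin t) ^ 2 = c := by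
  obtain ⟨θ, hθ⟩ := (Complex.norm_eq_one_iff (z := c)).1 hc
  refine ⟨-(θ / 2), ?_⟩
  rw [← hθ]
  have : (Real.cos (-(θ / 2)) : ℂ) - Complex.I * Real.sin (-(θ / 2)) =
      Complex.exp ((θ / 2 : ℝ) * Complex.I) := by
    rw [Complex.exp_mul_I, Real.cos_neg, Real.sin_neg, ← Complex.ofReal_cos, ← Complex.ofReal_sin]
    push_cast
    ring
  rw [this, ← Complex.exp_nat_mul]
  congr 1
  push_cast
  ring

end Literature.AnabelianGeometry.AbsoluteAnabelian
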